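import Summits.ResolutionOfSingularities.ResolutionOfSingularities.Theorems.EquisingularLiftEquisingularLiftNatNDModelInitChart
import Summits.ResolutionOfSingularities.ResolutionOfSingularities.Theorems.EquisingularLiftEquisingularLiftNatNDStarChart
import Summits.ResolutionOfSingularities.ResolutionOfSingularities.Theorems.EquisingularLiftEquisingularLiftNatNDRoundModelSplit
import Summits.ResolutionOfSingularities.ResolutionOfSingularities.Theorems.EquisingularLiftEquisingularLiftNatSNCStepAlgebra
import Literature.AlgebraicGeometry.Resolution.BlowupsFlatBaseChange
import HarnessLib

/-!
# [OURS · L1 W4.5(b) · EL♮(3) · ND-K5 (B4α1s)] THE CHART CLAUSE OF `ModelStep`: after a toric star every point of the new stage lies in a standard toric chart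

WIDTH core of the ND-K5 brick (B4α1s) `modelStep` (res-L1-w45b-idea-1's spec §13.14 `ND.ToricStage` (TS1) / `ND.ModelStep`, port ✓ p643982
`…NatNDRoundModelSplit`), `--supports stmt-ResolutionOfSingularities-20148`, no claim, counted 0 (res-L1-w45b-stub-4 g11).  AI-produced kernel work weaker than
expert review; no statement of [Hironaka2017] is used; EL♮(3) is NOT proved here.

WHAT.  `modelStep_chart`: at a toric stage (charts `h1` with `ψ = ND.toricChartHom`, smooth cones), for a face `τ` with two distinct rays, FRESH for the
cones not containing it, and ANY blow-up `υ` of the stratum `τ.sup E`, every point `x'` of the new stage lies in a standard toric chart for the starred fan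
`star Φ τ`, the stepped boundary `E.stepAlong (stratum E τ) (Σ τ) υ` and the strict transform `closure (υ⁻¹(T ∖ supp (stratum E τ)))`.  Per old chart
`(σ_B, B, c)` at `υ x'`, with the blow-up pulled back to the chart (`IsBlowup.pullback_snd_of_flat`, `pullback.fst` an open immersion): CASE `τ ⊄ σ_B` —
the centre is `⊤` on the chart (`finsetSup_eq_top_of_mem`), the pulled-back blow-up is an isomorphism (universal property against `𝟙`), chart `inv ≫ fst`, same
cone (kept by `star`) and matrix, strict transforms w.r.t. the unit centre are total transforms (`strictTransformIdeal_top_centre`), freshness gives `Σ τ ∉ σ_B`;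
CASE `τ ⊆ σ_B` — the centre pulls back to `𝓘_{J_τ}` (`finsetSup_coordHyperplane`), the pulled-back blow-up has the Literature charts
`AffineCoordBlowup.chartImm`, matrix `starChart B J_τ i₀` (✓ p644614 `…NatNDStarChart`: cone `∈ star Φ τ`, unit determinant, `Σ τ` not an old ray), the boundary
pulls back by `comap_strictTransformIdeal_of_flat` (twice) + `strictTransformIdeal_specMap_coordBlowupSubst` + `coordStrictTransformIdeal_span_singleton` /
`coordProperTransform_X_of_ne` / `_eq_top_of_X_mem` (✓ p642967), and `T` by `coordBlowupSubst_toricStrict` + the closure lemma with `y_{i₀} ∤ toricStrict B' g`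
(✓ p643256).  Plus: `isLocallyNoetherian_of_affine_charts` (a scheme covered by open immersions from `𝔸ⁿ` is locally Noetherian), `idealSheafOf_sup/_bot`,
`zeroLocus_X_pow_mul_diff`, `preimage_specMap_zeroLocus_ideal`, `top_pow_idealSheafData`.
-/

set_option linter.dupNamespace false

noncomputable section

open CategoryTheory CategoryTheory.Limits AlgebraicGeometry TopologicalSpace MvPolynomial
open Literature.AlgebraicGeometry.Resolution
open AlgebraicGeometry.Scheme.IdealSheafData

namespace Summit.ResolutionOfSingularities.ResolutionOfSingularities.Cruxes.EquisingularLiftNat.Sections.ND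

universe u

/-! ## Generic lemmas -/

/-- Powers of the unit ideal sheaf. [folklore] -/
theorem top_pow_idealSheafData {X : Scheme.{u}} (m : ℕ) : (⊤ : X.IdealSheafData) ^ m = ⊤ := by
  induction m with
  | zero => rw [pow_zero]; rfl
  | succ m ih => rw [pow_succ, ih, Scheme.IdealSheafData.top_mul]

/-- The strict transform with respect to the UNIT centre is the total transform. [folklore] -/
theorem strictTransformIdeal_top_centre {X X' : Scheme.{u}} (π : X' ⟶ X) (K : X.IdealSheafData) :
    strictTransformIdeal π ⊤ K = K.comap π := by
  rw [strictTransformIdeal, Scheme.IdealSheafData.comap_top]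
  simp_rw [top_pow_idealSheafData, colon_top]
  exact iSup_const

/-- A scheme covered by open immersions from affine spaces is locally Noetherian. [folklore] -/
theorem isLocallyNoetherian_of_affine_charts {n : ℕ} {k : Type} [Field k] {F : Scheme.{0}}
    (h : ∀ x : F, ∃ c : Aff n k ⟶ F, IsOpenImmersion c ∧ x ∈ Set.range c.base) : IsLocallyNoetherian F := by
  choose c hc hx using h
  let 𝒰 : F.OpenCover :=
    { I₀ := F
      X := fun _ => Aff n k
      f := c
      mem₀ := by
        rw [Scheme.presieve₀_mem_precoverage_iff]
        refine ⟨fun x => ⟨x, hx x⟩, fun x => hc x⟩ }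
  haveI : ∀ i, IsAffine (𝒰.X i) := fun _ => inferInstanceAs (IsAffine (Aff n k))
  rw [isLocallyNoetherian_iff_of_affine_openCover (𝒰 := 𝒰)]
  intro i
  exact isNoetherianRing_of_ringEquiv (R := MvPolynomial (Fin n) k) (Scheme.ΓSpecIso (.of (MvPolynomial (Fin n) k))).symm.commRingCatIsoToRingEquiv

/-! ## Dictionary: finite sups of coordinate hyperplanes -/

section Dict

variable (m : ℕ) (k : Type) [Field k]

/-- `idealSheafOf` respects binary sups. [folklore] -/
theorem idealSheafOf_sup {R : Type} [CommRing R] (I J : Ideal R) :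
    Hironaka2005.idealSheafOf (I ⊔ J) = Hironaka2005.idealSheafOf I ⊔ Hironaka2005.idealSheafOf J := by
  change equivOfIsAffine.symm _ = equivOfIsAffine.symm _ ⊔ equivOfIsAffine.symm _
  rw [Ideal.map_sup, map_sup]

/-- `idealSheafOf ⊥ = ⊥`. [folklore] -/
theorem idealSheafOf_bot {R : Type} [CommRing R] : Hironaka2005.idealSheafOf (⊥ : Ideal R) = ⊥ := by
  refine (idealSheafOf_eq_of_ideal_top_eq ?_).symm
  rw [Ideal.map_bot, Scheme.IdealSheafData.ideal_bot, Pi.bot_apply]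

/-- The sum of the coordinate hyperplane ideal sheaves over `J` is the coordinate-subspace ideal `𝓘_{J}`. [OURS · dictionary] -/
theorem finsetSup_coordHyperplane (J : Finset (Fin (m + 1))) :
    J.sup (coordHyperplane (m + 1) k) = AffineCoordBlowup.𝓘Λ m k (↑J : Set (Fin (m + 1))) := by
  classical
  rw [𝓘Λ_eq_idealSheafOf, AffineCoordBlowup.IΛ]
  induction J using Finset.induction_on with
  | empty => rw [Finset.sup_empty, Finset.coe_empty, Set.image_empty, Ideal.span_empty, idealSheafOf_bot]
  | insert j J hj ih =>
    rw [Finset.sup_insert, ih, coordHyperplane_eq_idealSheafOf, ← idealSheafOf_sup, Finset.coe_insert, Set.image_insert_eq]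
    congr 1
    rw [Set.insert_eq, Ideal.span_union]

end Dict

/-! ## The (TS1) chart clause of `ModelStep` -/

section StepChart

variable {n : ℕ} {k : Type} [Field k]

/-- Off a prime element, a power of it times `f` and `f` cut out the same set. [folklore] -/
theorem zeroLocus_X_pow_mul_diff {R : Type} [CommRing R] (y f : R) (a : ℕ) :
    PrimeSpectrum.zeroLocus {y ^ a * f} \ PrimeSpectrum.zeroLocus {y} = PrimeSpectrum.zeroLocus {f} \ PrimeSpectrum.zeroLocus ({y} : Set R) := by
  ext p
  simp only [Set.mem_sdiff, PrimeSpectrum.mem_zeroLocus, Set.singleton_subset_iff, SetLike.mem_coe]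
  constructor
  · rintro ⟨h1, h2⟩
    refine ⟨?_, h2⟩
    rcases p.2.mem_or_mem h1 with h | h
    · exact absurd (p.2.mem_of_pow_mem _ h) h2
    · exact h
  · rintro ⟨h1, h2⟩
    exact ⟨Ideal.mul_mem_left _ _ h1, h2⟩


/-- The Spec map of `φ` pulls the zero locus of an ideal back to the zero locus of its extension. [folklore] -/
theorem preimage_specMap_zeroLocus_ideal {R S : Type} [CommRing R] [CommRing S] (φ : R →+* S) (I : Ideal R) :
    (Spec.map (CommRingCat.ofHom φ)).base ⁻¹' PrimeSpectrum.zeroLocus (I : Set R) = PrimeSpectrum.zeroLocus ((I.map φ : Ideal S) : Set S) := by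
  ext p
  rw [Set.mem_preimage]
  change (I : Set R) ⊆ ((PrimeSpectrum.comap φ p).asIdeal : Set R) ↔ ((I.map φ : Ideal S) : Set S) ⊆ (p.asIdeal : Set S)
  rw [SetLike.coe_subset_coe, SetLike.coe_subset_coe, PrimeSpectrum.comap_asIdeal, Ideal.map_le_iff_le_comap]

/-- **(TS1) for `ModelStep`.**  At a toric stage (charts `h1`, smooth cones), after ANY blow-up `υ` of the stratum of a face `τ` with two distinct rays and
FRESH for the cones not containing it, every point of the new stage lies in a standard toric chart for the starred fan, the stepped boundary and the
strict transform.  Two cases per old chart `(σ_B, B, c)` at `υ x'`: `τ ⊄ σ_B` — the centre is the unit ideal on the chart, the blow-up pulled back to the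
chart is an isomorphism, same cone/matrix; `τ ⊆ σ_B` — the centre pulls back to `𝓘_{J_τ}`, the pulled-back blow-up (`IsBlowup.pullback_snd_of_flat`) has the
Literature charts `AffineCoordBlowup.chartImm`, matrix `starChart B J_τ i₀`, and the boundary / strict transform pull back by the dictionary
(`strictTransformIdeal_specMap_coordBlowupSubst`, `coordBlowupSubst_toricStrict`, the closure lemma).  [OURS · L1 W4.5b · ND-K5 (B4α1s) core] -/
theorem modelStep_chart (g : MvPolynomial (Fin n) k) (hg0 : g ≠ 0)
    {Φ : Finset (Finset (Ray n))} (hΦ : ∀ σ ∈ Φ, IsSmoothCone σ) {F : Scheme.{0}} (φ : F ⟶ Aff n k) (E : Boundary n F) (T : Set F)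
    (h1 : ∀ x : F, ∃ σ ∈ Φ, ∃ (B : Fin n → Fin n → ℕ) (c : Aff n k ⟶ F), IsOpenImmersion c ∧ x ∈ Set.range c.base ∧
      σ = Finset.univ.image (fun i => rayOf (B i)) ∧ IsUnit (zMat B).det ∧
      c ≫ φ = Spec.map (CommRingCat.ofHom (toricChartHom n k B)) ∧
      (∀ i, (E (rayOf (B i))).comap c = coordHyperplane n k i) ∧
      (∀ ρ, ρ ∉ σ → (E ρ).comap c = ⊤) ∧
      c ⁻¹' T = PrimeSpectrum.zeroLocus {toricStrict B g})
    {τ : Finset (Ray n)} (hτ2 : ∃ ρ₁ ∈ τ, ∃ ρ₂ ∈ τ, ρ₁ ≠ ρ₂) (hfresh : ∀ σ' ∈ Φ, ¬ τ ⊆ σ' → (∑ ρ ∈ τ, ρ) ∉ σ')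
    {F' : Scheme.{0}} (υ : F' ⟶ F) (hυ : IsBlowup υ (stratum E τ)) (x' : F') :
    ∃ σ' ∈ star Φ τ, ∃ (B' : Fin n → Fin n → ℕ) (c' : Aff n k ⟶ F'), IsOpenImmersion c' ∧ x' ∈ Set.range c'.base ∧
      σ' = Finset.univ.image (fun i => rayOf (B' i)) ∧ IsUnit (zMat B').det ∧
      c' ≫ (υ ≫ φ) = Spec.map (CommRingCat.ofHom (toricChartHom n k B')) ∧
      (∀ i, ((E.stepAlong (stratum E τ) (∑ ρ ∈ τ, ρ) υ) (rayOf (B' i))).comap c' = coordHyperplane n k i) ∧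
      (∀ ρ, ρ ∉ σ' → ((E.stepAlong (stratum E τ) (∑ ρ ∈ τ, ρ) υ) ρ).comap c' = ⊤) ∧
      c' ⁻¹' closure (υ ⁻¹' (T \ ((stratum E τ).support : Set F))) = PrimeSpectrum.zeroLocus {toricStrict B' g} := by
  classical
  -- `n ≠ 0`: two distinct rays
  obtain _ | m := n
  · obtain ⟨ρ₁, -, ρ₂, -, hne⟩ := hτ2
    exact absurd (Subsingleton.elim ρ₁ ρ₂) hne
  -- Noetherian instances
  haveI : IsLocallyNoetherian F :=
    isLocallyNoetherian_of_affine_charts fun x => by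
      obtain ⟨-, -, -, c, hc, hx, -⟩ := h1 x
      exact ⟨c, hc, hx⟩
  haveI : IsLocallyNoetherian F' := hυ.isLocallyNoetherian
  -- the old chart at `υ x'`
  obtain ⟨σ, hσΦ, B, c, hc, ⟨a, ha⟩, hσB, hdet, hcφ, hEi, hEρ, hcT⟩ := h1 (υ.base x')
  set C : F.IdealSheafData := stratum E τ with hCdef
  set ν : Ray (m + 1) := ∑ ρ ∈ τ, ρ with hν
  -- the pulled-back blow-up over the chart
  let p₁ : pullback υ c ⟶ F' := pullback.fst υ c
  let p₂ : pullback υ c ⟶ Aff (m + 1) k := pullback.snd υ c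
  have hsq : p₁ ≫ υ = p₂ ≫ c := pullback.condition
  have hp₂ : IsBlowup p₂ (C.comap c) := hυ.pullback_snd_of_flat c
  haveI : IsLocallyNoetherian (pullback υ c) := isLocallyNoetherian_of_isOpenImmersion p₁
  obtain ⟨z, hz₁, hz₂⟩ := Scheme.Pullback.exists_preimage_pullback (f := υ) (g := c) x' a ha.symm
  -- the centre on the chart
  have hCc : C.comap c = τ.sup fun ρ => (E ρ).comap c := by
    rw [hCdef, stratum, comap_finsetSup_fun]
  -- strict transforms pulled back to `pullback υ c`
  have hst1 : ∀ K : F.IdealSheafData, (strictTransformIdeal υ C K).comap p₁ = strictTransformIdeal p₂ (C.comap c) (K.comap c) :=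
    fun K => comap_strictTransformIdeal_of_flat c hsq C K
  -- preimages along `c' ≫ υ`
  have hpre : ∀ (c' : Aff (m + 1) k ⟶ F') (S : Set F), c'.base ⁻¹' (υ.base ⁻¹' S) = (c' ≫ υ).base ⁻¹' S := fun _ _ => rfl
  have hsuppC : c.base ⁻¹' (C.support : Set F) = ((C.comap c).support : Set (Aff (m + 1) k)) := by
    rw [support_comap, Closeds.coe_preimage]
  by_cases hτσ : τ ⊆ σ
  · ----------------------------------------------------------------
    -- CASE A: the face lies in the chart's cone — a genuine coordinate blow-up on the chart
    ----------------------------------------------------------------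
    set J : Finset (Fin (m + 1)) := Finset.univ.filter (fun j => rayOf (B j) ∈ τ) with hJ
    have hτB : τ ⊆ Finset.univ.image (fun i => rayOf (B i)) := hσB ▸ hτσ
    have hτJ : τ = J.image (fun i => rayOf (B i)) := face_eq_image_filter B hτB
    have hinjB := rayOf_injective_of_isUnit B hdet
    -- the centre on the chart is `𝓘_{J}`
    have hCJ : C.comap c = AffineCoordBlowup.𝓘Λ m k (↑J : Set (Fin (m + 1))) := by
      rw [hCc, ← finsetSup_coordHyperplane m k J]
      conv_lhs => rw [hτJ, Finset.sup_image]
      exact Finset.sup_congr rfl fun j _ => hEi j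
    have hp₂' : IsBlowup p₂ (AffineCoordBlowup.𝓘Λ m k (↑J : Set (Fin (m + 1)))) := hCJ ▸ hp₂
    -- the point `z` lies in some chart `i₀ ∈ J` of the pulled-back blow-up
    have hcov := AffineCoordBlowup.iSup_chart hp₂'
    have hz' : ∃ i : (↑J : Set (Fin (m + 1))), z ∈ AffineCoordBlowup.chart (↑J : Set (Fin (m + 1))) p₂ (i : Fin (m + 1)) :=
      Opens.mem_iSup.mp (by rw [hcov]; trivial)
    obtain ⟨⟨i₀, hi₀⟩, hzi⟩ := hz'
    have hi₀J : i₀ ∈ J := hi₀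
    have hi₀τ : rayOf (B i₀) ∈ τ := (Finset.mem_filter.mp hi₀J).2
    let ch : Aff (m + 1) k ⟶ pullback υ c := AffineCoordBlowup.chartImm hp₂' hi₀
    have hch : ch ≫ p₂ = Spec.map (CommRingCat.ofHom (coordBlowupSubst k (↑J : Set (Fin (m + 1))) i₀).toRingHom) :=
      AffineCoordBlowup.chartImm_comp hp₂' hi₀
    have hchsq : ch ≫ p₂ = Spec.map (CommRingCat.ofHom (coordBlowupSubst k (↑J : Set (Fin (m + 1))) i₀).toRingHom) ≫ 𝟙 _ := by
      rw [Category.comp_id]; exact hch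
    let c' : Aff (m + 1) k ⟶ F' := ch ≫ p₁
    have hc'υ : c' ≫ υ = Spec.map (CommRingCat.ofHom (coordBlowupSubst k (↑J : Set (Fin (m + 1))) i₀).toRingHom) ≫ c := by
      change (ch ≫ p₁) ≫ υ = _
      rw [Category.assoc, hsq, ← Category.assoc, hch]
    set B' := starChart B J i₀ with hB'
    have hdet' : IsUnit (zMat B').det := isUnit_det_zMat_starChart B hdet J hi₀J
    -- the new ray and its freshness for the chart's cone
    have hνB : ν = rayOf (B' i₀) := by rw [hB', rayOf_starChart_self, hν, sum_face_eq_sum_rayOf B hdet hτB]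
    have hνσ : ν ∉ σ := sum_face_notMem_of_isSmoothCone (hΦ σ hσΦ) hτσ hτ2
    have hνi : ∀ i, i ≠ i₀ → rayOf (B' i) ≠ ν := by
      intro i hi h
      apply hνσ
      rw [← h, hB', starChart_of_ne B J hi, hσB]
      exact Finset.mem_image.mpr ⟨i, Finset.mem_univ _, rfl⟩
    -- strict transforms in the new chart
    have hst : ∀ i : Fin (m + 1),
        ((strictTransformIdeal υ C (E (rayOf (B i)))).comap c') =
          Hironaka2005.idealSheafOf (coordStrictTransformIdeal k (↑J : Set (Fin (m + 1))) i₀ (Ideal.span {(X i : MvPolynomial (Fin (m + 1)) k)})) := by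
      intro i
      change (strictTransformIdeal υ C (E (rayOf (B i)))).comap (ch ≫ p₁) = _
      rw [Scheme.IdealSheafData.comap_comp, hst1, comap_strictTransformIdeal_of_flat (𝟙 (Aff (m + 1) k)) hchsq,
        Scheme.IdealSheafData.comap_id, Scheme.IdealSheafData.comap_id, hCJ, hEi, 𝓘Λ_eq_idealSheafOf, AffineCoordBlowup.IΛ,
        coordHyperplane_eq_idealSheafOf, AlgHom.toRingHom_eq_coe, strictTransformIdeal_specMap_coordBlowupSubst k _ i₀ hi₀]
    have hst_top : ∀ ρ, ρ ∉ σ → ((strictTransformIdeal υ C (E ρ)).comap c') = ⊤ := by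
      intro ρ hρ
      change (strictTransformIdeal υ C (E ρ)).comap (ch ≫ p₁) = _
      rw [Scheme.IdealSheafData.comap_comp, hst1, hEρ ρ hρ, strictTransformIdeal_top, Scheme.IdealSheafData.comap_top]
    refine ⟨Finset.univ.image (fun i => rayOf (B' i)), ?_, B', c', inferInstance, ?_, rfl, hdet', ?_, ?_, ?_, ?_⟩
    · -- the new cone lies in the starred fan
      rw [hB', hJ]
      exact image_rayOf_starChart_mem_star B hdet (hσB ▸ hσΦ) hτB hi₀τ
    · -- x' ∈ range c'
      have hz'' : z ∈ ch.opensRange := by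
        rw [AffineCoordBlowup.opensRange_chartImm hp₂' hi₀]; exact hzi
      obtain ⟨w, hw⟩ := (show z ∈ Set.range ch.base from hz'')
      exact ⟨w, by change p₁.base (ch.base w) = x'; rw [hw]; exact hz₁⟩
    · -- c' ≫ υ ≫ φ = Spec (toricChartHom B')
      rw [← Category.assoc, hc'υ, Category.assoc, hcφ, ← Spec.map_comp, ← CommRingCat.ofHom_comp]
      congr 2
      refine RingHom.ext fun q => ?_
      change coordBlowupSubst k (↑J : Set (Fin (m + 1))) i₀ (toricChartHom (m + 1) k B q) = toricChartHom (m + 1) k B' q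
      rw [toricChartHom, toricChartHom, AlgHom.toRingHom_eq_coe, AlgHom.toRingHom_eq_coe, RingHom.coe_coe, RingHom.coe_coe,
        ← chartPull_eq_aeval, ← chartPull_eq_aeval, coordBlowupSubst_chartPull B q J hi₀J]
    · -- the boundary on the new cone's rays
      intro i
      by_cases hi : i = i₀
      · subst hi
        rw [← hνB, hν, stepAlong_self, ← Scheme.IdealSheafData.comap_comp, hc'υ, Scheme.IdealSheafData.comap_comp, hCJ,
          𝓘Λ_eq_idealSheafOf, AffineCoordBlowup.IΛ, AlgHom.toRingHom_eq_coe, Hironaka2005.comap_specMap_idealSheafOf, Ideal.map_coe,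
          map_coordBlowupSubst_span_eq k _ i hi₀, coordHyperplane_eq_idealSheafOf]
      · have hBi : rayOf (B' i) = rayOf (B i) := by rw [hB', starChart_of_ne B J hi]
        rw [hBi, stepAlong_of_ne _ _ (hBi ▸ hνi i hi), hst i,
          coordStrictTransformIdeal_span_singleton k _ i₀ hi₀ (X_ne_zero i), coordProperTransform_X_of_ne k _ i₀ hi,
          coordHyperplane_eq_idealSheafOf]
    · -- the boundary off the new cone
      intro ρ hρ
      rw [image_rayOf_starChart B hdet, Finset.mem_insert, not_or, Finset.mem_erase, not_and_or, not_not] at hρ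
      obtain ⟨hρν, hρ'⟩ := hρ
      have hρν' : ρ ≠ ν := by rw [hν, sum_face_eq_sum_rayOf B hdet hτB]; exact hρν
      rw [stepAlong_of_ne _ _ hρν']
      rcases hρ' with hρ0 | hρσ
      · rw [hρ0, hst i₀, coordStrictTransformIdeal_eq_top_of_X_mem k _ i₀ (Ideal.mem_span_singleton_self _), idealSheafOf_top']
      · exact hst_top ρ (hσB ▸ hρσ)
    · -- the strict transform of `T`
      have hopen : IsOpenMap c'.base := c'.isOpenEmbedding.isOpenMap
      rw [hopen.preimage_closure_eq_closure_preimage c'.base.hom.continuous, hpre, hc'υ]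
      change closure ((Spec.map (CommRingCat.ofHom (coordBlowupSubst k (↑J : Set (Fin (m + 1))) i₀).toRingHom)).base ⁻¹'
        (c.base ⁻¹' (T \ (C.support : Set F)))) = _
      rw [Set.preimage_sdiff, hcT, hsuppC, hCJ, AffineCoordBlowup.support_𝓘Λ, Set.preimage_sdiff, preimage_specMap_zeroLocus]
      have hpreC : (Spec.map (CommRingCat.ofHom (coordBlowupSubst k (↑J : Set (Fin (m + 1))) i₀).toRingHom)).base ⁻¹'
          ((AffineCoordBlowup.CΛ m k (↑J : Set (Fin (m + 1))) : Closeds _) : Set _) =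
            PrimeSpectrum.zeroLocus {(X i₀ : MvPolynomial (Fin (m + 1)) k)} := by
        change (Spec.map (CommRingCat.ofHom (coordBlowupSubst k (↑J : Set (Fin (m + 1))) i₀).toRingHom)).base ⁻¹'
          PrimeSpectrum.zeroLocus ((AffineCoordBlowup.IΛ m k (↑J : Set (Fin (m + 1))) : Ideal (MvPolynomial (Fin (m + 1)) k)) :
            Set (MvPolynomial (Fin (m + 1)) k)) = _
        rw [preimage_specMap_zeroLocus_ideal, AlgHom.toRingHom_eq_coe, Ideal.map_coe, AffineCoordBlowup.IΛ,
          map_coordBlowupSubst_span_eq k _ i₀ hi₀, PrimeSpectrum.zeroLocus_span]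
      rw [hpreC]
      change closure (PrimeSpectrum.zeroLocus {coordBlowupSubst k (↑J : Set (Fin (m + 1))) i₀ (toricStrict B g)} \ _) = _
      rw [coordBlowupSubst_toricStrict B g J hi₀J, zeroLocus_X_pow_mul_diff]
      have hdetZ := zdet_ne_zero_of_isUnit B' hdet'
      have hinj' : Set.InjOn (chartExp B') (table g) := (chartExp_injective_of_det_ne_zero _ hdetZ).injOn
      exact closure_zeroLocus_diff_zeroLocus_of_not_dvd (prime_X_of_isDomain k i₀) (not_X_dvd_toricStrict B' g hinj' hg0 i₀)
  · ----------------------------------------------------------------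
    -- CASE B: the face is not in the chart's cone — the blow-up is an isomorphism over the chart
    ----------------------------------------------------------------
    obtain ⟨ρ₀, hρ₀τ, hρ₀σ⟩ := Finset.not_subset.mp hτσ
    have hCtop : C.comap c = ⊤ := by
      rw [hCc]; exact finsetSup_eq_top_of_mem hρ₀τ (hEρ ρ₀ hρ₀σ)
    haveI : IsIso p₂ := by
      -- a blow-up along the unit ideal sheaf is an isomorphism (universal property against `𝟙`; cf. `WeightTwoB.isIso_of_isBlowup_top`)
      rw [hCtop] at hp₂
      have hid : IsEffectiveCartier ((⊤ : (Aff (m + 1) k).IdealSheafData).comap (𝟙 _)) := (isBlowup_id_top (Aff (m + 1) k)).isEffectiveCartier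
      obtain ⟨g', hg', -⟩ := hp₂.universal (𝟙 _) hid
      obtain ⟨k', -, hku⟩ := hp₂.universal p₂ hp₂.isEffectiveCartier
      have hτg : p₂ ≫ g' = 𝟙 _ := by
        rw [hku (p₂ ≫ g') (show (p₂ ≫ g') ≫ p₂ = p₂ by rw [Category.assoc, hg', Category.comp_id]),
          hku (𝟙 _) (show 𝟙 _ ≫ p₂ = p₂ from Category.id_comp p₂)]
      exact ⟨g', hτg, hg'⟩
    let c' : Aff (m + 1) k ⟶ F' := inv p₂ ≫ p₁
    have hc'υ : c' ≫ υ = c := by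
      change (inv p₂ ≫ p₁) ≫ υ = c
      rw [Category.assoc, hsq, IsIso.inv_hom_id_assoc]
    have hνσ : ν ∉ σ := hfresh σ hσΦ hτσ
    have hst : ∀ K : F.IdealSheafData, (strictTransformIdeal υ C K).comap c' = K.comap c := by
      intro K
      change (strictTransformIdeal υ C K).comap (inv p₂ ≫ p₁) = _
      rw [Scheme.IdealSheafData.comap_comp, hst1, hCtop, strictTransformIdeal_top_centre, ← Scheme.IdealSheafData.comap_comp,
        IsIso.inv_hom_id, Scheme.IdealSheafData.comap_id]
    refine ⟨σ, ?_, B, c', inferInstance, ?_, hσB, hdet, ?_, ?_, ?_, ?_⟩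
    · exact (mem_star_iff Φ τ σ).mpr (Or.inl ⟨hσΦ, hτσ⟩)
    · refine ⟨p₂.base z, ?_⟩
      change ((p₂ ≫ inv p₂) ≫ p₁).base z = x'
      rw [IsIso.hom_inv_id, Category.id_comp]; exact hz₁
    · rw [← Category.assoc, hc'υ, hcφ]
    · intro i
      have hne : rayOf (B i) ≠ ν := by
        intro h; apply hνσ; rw [← h, hσB]; exact Finset.mem_image.mpr ⟨i, Finset.mem_univ _, rfl⟩
      rw [stepAlong_of_ne _ _ hne, hst, hEi]
    · intro ρ hρ
      by_cases hρν : ρ = ν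
      · rw [hρν, hν, stepAlong_self, ← Scheme.IdealSheafData.comap_comp, hc'υ, hCtop]
      · rw [stepAlong_of_ne _ _ hρν, hst, hEρ ρ hρ]
    · have hopen : IsOpenMap c'.base := c'.isOpenEmbedding.isOpenMap
      rw [hopen.preimage_closure_eq_closure_preimage c'.base.hom.continuous, hpre, hc'υ, Set.preimage_sdiff, hcT, hsuppC, hCtop,
        Scheme.IdealSheafData.support_top, Closeds.coe_bot]
      have hcl : closure ((PrimeSpectrum.zeroLocus {toricStrict B g} : Set (PrimeSpectrum (MvPolynomial (Fin (m + 1)) k))) \ ∅) =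
          PrimeSpectrum.zeroLocus {toricStrict B g} := by
        rw [Set.sdiff_empty]; exact (PrimeSpectrum.isClosed_zeroLocus _).closure_eq
      exact hcl

end StepChart

end Summit.ResolutionOfSingularities.ResolutionOfSingularities.Cruxes.EquisingularLiftNat.Sections.ND

end
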